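import Literature.NumberTheory.Sieve.GoldstonGrahamPintzYildirim
import Literature.NumberTheory.Sieve.CoprimeSquarefreeSumsSmooth
import HarnessLib

/-!
# Goldston–Graham–Pintz–Yıldırım 2009, Lemma 4 from Lemma 3 (`κ = 1`): the partial summation

Topic `Literature/NumberTheory/Sieve`; sequel of `GoldstonGrahamPintzYildirim.lean` (the named facts
`GGPY.moebiusSqGSum_asymptotic` = Lemma 3 and `GGPY.moebiusSqGSumWeighted_asymptotic` = Lemma 4 of
D. A. Goldston, S. W. Graham, J. Pintz, C. Y. Yıldırım, *Small gaps between products of two primes*,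
Proc. Lond. Math. Soc. (3) 98 (2009), 741–774, §2, in dimension `κ = 1`). This file PROVES the
printed deduction of Lemma 4 from Lemma 3 (pp. 6–7 of the arXiv text: "The left-hand side … is
`∫_{1⁻}^z F(log(z/u)/log z) dG(u)`, where `G(u) = ∑_{d<u} μ²(d) g(d) = c_γ log u + E(u)` and
`E(u) ≪ c_γ L` by the previous lemma … change of variables `u = z^x` … integration by parts on the
second integral"):

* `GGPY.moebiusSqGSumWeighted_asymptotic_of` —
  `moebiusSqGSum_asymptotic → moebiusSqGSumWeighted_asymptotic` (with `C = 6 (C₃⁺ + 1)`).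

Proof (Abel summation, Mathlib's `sum_mul_eq_sub_integral_mul₀`, as in the tree's
`SquarefreeSums.abs_sum_wfun_smooth_sub_le`): with `T(t) = ∑_{d ≤ t} μ² g = G(⌊t⌋ + 1)`, Lemma 3 at
`⌊t⌋ + 1` gives `T(t) = c_γ log t + r(t)`, `|r| ≤ (C₃⁺ + 1) c_γ L` on `[1, z]` (Lemma 3 at `z = 2`, where
the sum is `1`, yields `1 ≤ (log 2 + C₃⁺) c_γ L`, which bounds the terms `O(c_γ)` and the single
boundary term `d = z`, present when `z` is an integer since the sum runs over `d < z`, by `O(c_γ L)`);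
then `∑_{d ≤ z} μ² g(d) f(d) = f(z) T(z) − ∫₁ᶻ f' T` with `f(t) = F(1 − log t/log z)`,
`∫₁ᶻ f' log = log z (F(0) − ∫₀¹ F(1−s) ds)` (`SquarefreeSums.integral_comp_log_div`) and
`|∫₁ᶻ f' r| ≤ M ρ ∫₁ᶻ dt/(t log z) = M ρ`.

## References

* D. A. Goldston, S. W. Graham, J. Pintz, C. Y. Yıldırım, *Small gaps between products of two
  primes*, Proc. Lond. Math. Soc. (3) 98 (2009), 741–774, doi:10.1112/plms/pdn046,
  arXiv:math/0609615 [GoldstonEtAl2008]: Lemma 4 and its proof (pp. 6–7).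
-/

noncomputable section

open Finset Filter Real MeasureTheory Set
open scoped Topology ArithmeticFunction.Moebius

namespace Literature.NumberTheory.Sieve

namespace GGPY

/-- The partial products of `c_γ` are positive under `(Ω₁)` with `A₁ > 0` (each factor
`(1 − γ(p)/p)⁻¹ (1 − 1/p)` is positive since `γ(p)/p ≤ 1 − 1/A₁ < 1`). [folklore] -/
theorem cGammaPartial_pos {γ : ℕ → ℝ} {A₁ : ℝ} (hA₁ : 0 < A₁) (h1 : HypOmega1 γ A₁) (y : ℕ) :
    0 < cGammaPartial γ y := by
  unfold cGammaPartial
  refine Finset.prod_pos fun p hp => ?_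
  have hpp := (Nat.mem_primesBelow.1 hp).2
  have hp2 : (2 : ℝ) ≤ p := by exact_mod_cast hpp.two_le
  have hγ := (h1 p hpp).2
  have hA : 0 < 1 / A₁ := by positivity
  have hlt : γ p / p < 1 := by linarith
  have hfac1 : 0 < 1 - γ p / p := by linarith
  have hfac2 : 0 < 1 - 1 / (p : ℝ) := by
    have : 1 / (p : ℝ) ≤ 1 / 2 := by
      rw [div_le_div_iff₀ (by linarith) two_pos]; linarith
    linarith
  exact mul_pos (inv_pos.2 hfac1) hfac2

/-- Hence `c_γ ≥ 0` whenever the partial products converge to it. [folklore] -/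
theorem cGamma_nonneg {γ : ℕ → ℝ} {A₁ : ℝ} (hA₁ : 0 < A₁) (h1 : HypOmega1 γ A₁)
    (ht : Tendsto (cGammaPartial γ) atTop (𝓝 (cGamma γ))) : 0 ≤ cGamma γ :=
  ge_of_tendsto' ht fun y => (cGammaPartial_pos hA₁ h1 y).le

/-- `∑_{d<2} μ² g = μ(1)² g(1) = 1`. [folklore] -/
theorem moebiusSqGSum_two (γ : ℕ → ℝ) : moebiusSqGSum γ 2 = 1 := by
  unfold moebiusSqGSum
  have : ⌈(2 : ℝ)⌉₊ = 2 := by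
    rw [show (2 : ℝ) = ((2 : ℕ) : ℝ) by norm_num, Nat.ceil_natCast]
  rw [this, show Finset.Ico 1 2 = {1} by rfl, Finset.sum_singleton, g_one]
  simp

/-- The step function of the partial summation: `T(t) = ∑_{1 ≤ d ≤ ⌊t⌋} μ² g(d) = ∑_{d < ⌊t⌋+1} μ² g(d)`. [folklore] -/
theorem sum_Icc_floor_eq_moebiusSqGSum (γ : ℕ → ℝ) (t : ℝ) :
    ∑ d ∈ Icc 1 ⌊t⌋₊, ((μ d : ℤ) : ℝ) ^ 2 * g γ d = moebiusSqGSum γ ((⌊t⌋₊ + 1 : ℕ) : ℝ) := by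
  unfold moebiusSqGSum
  rw [Nat.ceil_natCast]
  rfl

/-- **Goldston–Graham–Pintz–Yıldırım 2009, Lemma 4 from Lemma 3** (`κ = 1`), by the printed
partial summation (pp. 6–7): `moebiusSqGSum_asymptotic` implies `moebiusSqGSumWeighted_asymptotic`,
with the constant `6 (max C₃ 0 + 1)`. [cite: GoldstonEtAl2008, Lemma 4 and its proof (pp. 6–7)] -/
theorem moebiusSqGSumWeighted_asymptotic_of (h3 : moebiusSqGSum_asymptotic) :
    moebiusSqGSumWeighted_asymptotic := by
  intro A₁ A₂ hA₁ hA₂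
  obtain ⟨C₃, hC₃⟩ := h3 A₁ A₂ hA₁ hA₂
  set C₃' := max C₃ 0 with hC₃'
  have hC₃'0 : 0 ≤ C₃' := le_max_right _ _
  refine ⟨6 * (C₃' + 1), ?_⟩
  intro L hL γ h1 h2 F hF M hM z hz
  obtain ⟨htend, hasym⟩ := hC₃ L hL γ h1 h2
  set c := cGamma γ with hcdef
  have hc0 : 0 ≤ c := cGamma_nonneg hA₁ h1 htend
  have hL0 : 0 ≤ L := by linarith
  -- Lemma 3 with `C₃'` in place of `C₃`
  have hasym' : ∀ z' : ℝ, 2 ≤ z' → |moebiusSqGSum γ z' - c * Real.log z'| ≤ C₃' * c * L := by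
    intro z' hz'
    refine (hasym z' hz').trans ?_
    have : 0 ≤ c * L := mul_nonneg hc0 hL0
    calc C₃ * c * L = C₃ * (c * L) := by ring
      _ ≤ C₃' * (c * L) := mul_le_mul_of_nonneg_right (le_max_left _ _) this
      _ = C₃' * c * L := by ring
  -- the lower bound `1 ≤ (log 2 + C₃') c L` from `z' = 2`
  have hlog2 : 0 < Real.log 2 := Real.log_pos one_lt_two
  have hlog2' : Real.log 2 ≤ 1 := by have := Real.log_two_lt_d9; linarith
  have hlow : 1 ≤ (Real.log 2 + C₃') * (c * L) := by
    have h := hasym' 2 le_rfl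
    rw [moebiusSqGSum_two] at h
    have h' := (abs_le.1 h).2
    -- `1 − c log 2 ≤ C₃' c L`, and `c log 2 ≤ c L log 2`
    have e : c * Real.log 2 * 1 ≤ c * Real.log 2 * L :=
      mul_le_mul_of_nonneg_left hL (mul_nonneg hc0 hlog2.le)
    have : (Real.log 2 + C₃') * (c * L) = C₃' * c * L + c * Real.log 2 * L := by ring
    rw [this]
    linarith [h', e]
  -- the error level `ρ = (C₃' + 1) c L`
  set ρ := (C₃' + 1) * (c * L) with hρ
  have hcL0 : 0 ≤ c * L := mul_nonneg hc0 hL0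
  have hρ0 : 0 ≤ ρ := by rw [hρ]; positivity
  have hcρ : c ≤ ρ := by
    have hcL : c ≤ c * L := le_mul_of_one_le_right hc0 hL
    have h3 : 0 ≤ C₃' * (c * L) := mul_nonneg hC₃'0 hcL0
    calc c ≤ c * L := hcL
      _ ≤ C₃' * (c * L) + c * L := by linarith
      _ = ρ := by rw [hρ]; ring
  have h1ρ : (1 : ℝ) ≤ 2 * ρ := by
    have h3 : (Real.log 2 + C₃') * (c * L) ≤ ρ := by
      rw [hρ]; exact mul_le_mul_of_nonneg_right (by linarith) hcL0
    linarith [hlow, h3, hρ0]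
  -- basic facts about `z`
  have hz1 : 1 < z := by linarith
  have hz0 : 0 < z := by linarith
  have hLz : 0 < Real.log z := Real.log_pos hz1
  have hM0 : 0 ≤ M := le_trans (by positivity) (hM 0 ⟨le_rfl, zero_le_one⟩)
  -- the smooth function `G(s) = F(1 − s)` and its bounds
  set G : ℝ → ℝ := fun s => F (1 - s) with hGdef
  have hG : ContDiff ℝ 1 G := hF.comp (contDiff_const.sub contDiff_id)
  have hGd : Differentiable ℝ G := hG.differentiable one_ne_zero
  have hG'c : Continuous (deriv G) := hG.continuous_deriv le_rfl
  have hGc : Continuous G := hG.continuous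
  have hGM : ∀ s ∈ Set.Icc (0 : ℝ) 1, |G s| ≤ M := by
    intro s hs
    have := hM (1 - s) ⟨by linarith [hs.2], by linarith [hs.1]⟩
    have h0 : 0 ≤ |deriv F (1 - s)| := abs_nonneg _
    rw [hGdef]; dsimp only; linarith
  have hG'M : ∀ s ∈ Set.Icc (0 : ℝ) 1, |deriv G s| ≤ M := by
    intro s hs
    have := hM (1 - s) ⟨by linarith [hs.2], by linarith [hs.1]⟩
    have h0 : 0 ≤ |F (1 - s)| := abs_nonneg _
    rw [hGdef, deriv_comp_const_sub, abs_neg]; linarith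
  -- the coefficients and the step function
  obtain ⟨cs, hcs⟩ : ∃ cs : ℕ → ℝ, cs = fun n => if n = 0 then 0 else ((μ n : ℤ) : ℝ) ^ 2 * g γ n :=
    ⟨_, rfl⟩
  have hcs0 : cs 0 = 0 := by rw [hcs]; simp
  have hcsn : ∀ n, n ≠ 0 → cs n = ((μ n : ℤ) : ℝ) ^ 2 * g γ n := fun n hn => by rw [hcs]; simp [hn]
  obtain ⟨T, hT⟩ : ∃ T : ℝ → ℝ, T = fun t => ∑ k ∈ Icc 0 ⌊t⌋₊, cs k := ⟨_, rfl⟩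
  have hT1 : ∀ t, T t = moebiusSqGSum γ ((⌊t⌋₊ + 1 : ℕ) : ℝ) := by
    intro t
    rw [hT]
    dsimp only
    rw [Icc_eq_cons_Ioc (Nat.zero_le _), sum_cons, hcs0, zero_add, ← Finset.Icc_add_one_left_eq_Ioc,
      zero_add, ← sum_Icc_floor_eq_moebiusSqGSum]
    refine Finset.sum_congr rfl fun n hn => hcsn n ?_
    have := (Finset.mem_Icc.1 hn).1; omega
  -- `r = T − c log` is at most `ρ` on `[1, ∞)`
  have hr : ∀ t : ℝ, 1 ≤ t → |T t - c * Real.log t| ≤ ρ := by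
    intro t ht
    have ht0 : 0 < t := by linarith
    set n := ⌊t⌋₊ with hn
    have hn1 : 1 ≤ n := Nat.le_floor (by exact_mod_cast ht)
    have hn2 : (2 : ℝ) ≤ ((n + 1 : ℕ) : ℝ) := by exact_mod_cast (show 2 ≤ n + 1 by omega)
    have ha := hasym' _ hn2
    rw [← hT1 t] at ha
    -- `|c log(n+1) − c log t| ≤ c log 2 ≤ c`
    have hlt : t < (n : ℝ) + 1 := Nat.lt_floor_add_one t
    have hle : (n : ℝ) ≤ t := Nat.floor_le ht0.le
    have hlogs : |c * Real.log ((n + 1 : ℕ) : ℝ) - c * Real.log t| ≤ c := by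
      rw [← mul_sub, abs_mul, abs_of_nonneg hc0]
      refine mul_le_of_le_one_right hc0 ?_
      push_cast
      rw [← Real.log_div (by positivity) ht0.ne', abs_le]
      constructor
      · have : 0 ≤ Real.log (((n : ℝ) + 1) / t) := Real.log_nonneg (by rw [le_div_iff₀ ht0]; linarith)
        linarith
      · calc Real.log (((n : ℝ) + 1) / t) ≤ Real.log 2 := by
              refine Real.log_le_log (by positivity) ?_
              rw [div_le_iff₀ ht0]; linarith
          _ ≤ 1 := hlog2'
    calc |T t - c * Real.log t|
        = |(T t - c * Real.log ((n + 1 : ℕ) : ℝ)) + (c * Real.log ((n + 1 : ℕ) : ℝ) - c * Real.log t)| := by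
          ring_nf
      _ ≤ |T t - c * Real.log ((n + 1 : ℕ) : ℝ)| + |c * Real.log ((n + 1 : ℕ) : ℝ) - c * Real.log t| :=
          abs_add_le _ _
      _ ≤ C₃' * c * L + c := add_le_add ha hlogs
      _ ≤ ρ := by rw [hρ]; nlinarith
  -- the jump of `T` at an integer `n ≥ 2` is small: `|cs n| ≤ c + 2ρ`
  have hjump : ∀ n : ℕ, 2 ≤ n → |cs n| ≤ c + 2 * ρ := by
    intro n hn
    obtain ⟨n', rfl⟩ : ∃ n', n = n' + 1 := ⟨n - 1, by omega⟩
    have hTn : T ((n' + 1 : ℕ) : ℝ) = T (n' : ℝ) + cs (n' + 1) := by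
      rw [hT]; dsimp only
      rw [Nat.floor_natCast, Nat.floor_natCast, Finset.sum_Icc_succ_top (Nat.zero_le _)]
    have hcsn' : cs (n' + 1) = (T ((n' + 1 : ℕ) : ℝ) - c * Real.log ((n' + 1 : ℕ) : ℝ)) -
        (T (n' : ℝ) - c * Real.log (n' : ℝ))
        + (c * Real.log ((n' + 1 : ℕ) : ℝ) - c * Real.log (n' : ℝ)) := by rw [hTn]; ring
    have hn1 : (1 : ℝ) ≤ (n' : ℝ) := by exact_mod_cast (show 1 ≤ n' by omega)
    have hnr : (1 : ℝ) ≤ ((n' + 1 : ℕ) : ℝ) := by exact_mod_cast (show 1 ≤ n' + 1 by omega)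
    have e1 := hr _ hnr
    have e2 := hr _ hn1
    have e3 : |c * Real.log ((n' + 1 : ℕ) : ℝ) - c * Real.log (n' : ℝ)| ≤ c := by
      rw [← mul_sub, abs_mul, abs_of_nonneg hc0]
      refine mul_le_of_le_one_right hc0 ?_
      have hpos : (0 : ℝ) < (n' : ℝ) := by linarith
      push_cast
      rw [← Real.log_div (by positivity) hpos.ne', abs_le]
      constructor
      · have : 0 ≤ Real.log (((n' : ℝ) + 1) / (n' : ℝ)) :=
          Real.log_nonneg (by rw [le_div_iff₀ hpos]; linarith)
        linarith
      · calc Real.log (((n' : ℝ) + 1) / (n' : ℝ)) ≤ Real.log 2 := by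
              refine Real.log_le_log (by positivity) ?_
              rw [div_le_iff₀ hpos]
              linarith
          _ ≤ 1 := hlog2'
    rw [hcsn']
    calc |_ - _ + _| ≤ |(T ((n' + 1 : ℕ) : ℝ) - c * Real.log ((n' + 1 : ℕ) : ℝ)) -
          (T (n' : ℝ) - c * Real.log (n' : ℝ))| +
          |c * Real.log ((n' + 1 : ℕ) : ℝ) - c * Real.log (n' : ℝ)| := abs_add_le _ _
      _ ≤ (|T ((n' + 1 : ℕ) : ℝ) - c * Real.log ((n' + 1 : ℕ) : ℝ)| +
          |T (n' : ℝ) - c * Real.log (n' : ℝ)|) + c := add_le_add (abs_sub _ _) e3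
      _ ≤ ρ + ρ + c := by linarith
      _ = c + 2 * ρ := by ring
  -- the weighted sum as `∑_{d ≤ ⌊z⌋} cs d · f(d)` minus a boundary term
  obtain ⟨f, hf⟩ : ∃ f : ℝ → ℝ, f = fun t => G (Real.log t / Real.log z) := ⟨_, rfl⟩
  have hfd' : ∀ d : ℕ, d ≠ 0 → f d = F (Real.log (z / d) / Real.log z) := by
    intro d hd
    rw [hf, hGdef]; dsimp only
    congr 1
    rw [Real.log_div hz0.ne' (by exact_mod_cast hd)]
    field_simp
  have hIcoIcc : ∀ n : ℕ, Finset.Ico 1 (n + 1) = Finset.Icc 1 n := fun n => by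
    ext k; simp
  have hterm : ∀ d : ℕ, d ≠ 0 → f d * cs d =
      ((μ d : ℤ) : ℝ) ^ 2 * g γ d * F (Real.log (z / d) / Real.log z) := by
    intro d hd
    rw [hcsn d hd, hfd' d hd]; ring
  have hSIcc : ∑ k ∈ Icc 0 ⌊z⌋₊, f k * cs k =
      ∑ d ∈ Icc 1 ⌊z⌋₊, ((μ d : ℤ) : ℝ) ^ 2 * g γ d * F (Real.log (z / d) / Real.log z) := by
    rw [Icc_eq_cons_Ioc (Nat.zero_le _), sum_cons, hcs0, mul_zero, zero_add,
      ← Finset.Icc_add_one_left_eq_Ioc, zero_add]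
    exact Finset.sum_congr rfl fun d hd => hterm d (by have := (Finset.mem_Icc.1 hd).1; omega)
  have hfl1 : 1 ≤ ⌊z⌋₊ := Nat.le_floor (by exact_mod_cast hz1.le)
  have hweighted : moebiusSqGSumWeighted γ F z =
      ∑ k ∈ Icc 0 ⌊z⌋₊, f k * cs k - (if ((⌊z⌋₊ : ℕ) : ℝ) = z then f ⌊z⌋₊ * cs ⌊z⌋₊ else 0) := by
    rw [hSIcc]
    unfold moebiusSqGSumWeighted
    by_cases hint : ((⌊z⌋₊ : ℕ) : ℝ) = z
    · -- `z` is an integer `n = ⌊z⌋ ≥ 2`: `Ico 1 ⌈z⌉ = Ico 1 n = Icc 1 (n - 1)`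
      rw [if_pos hint]
      have hceil : ⌈z⌉₊ = ⌊z⌋₊ := by rw [← hint, Nat.ceil_natCast, Nat.floor_natCast]
      rw [hceil]
      set n := ⌊z⌋₊ with hn
      obtain ⟨n', hn'⟩ : ∃ n', n = n' + 1 := ⟨n - 1, by omega⟩
      rw [hn', Finset.sum_Icc_succ_top (by omega), hIcoIcc, hterm (n' + 1) (by omega)]
      ring
    · -- `z` is not an integer: `⌈z⌉ = ⌊z⌋ + 1`
      rw [if_neg hint, sub_zero]
      have hceil : ⌈z⌉₊ = ⌊z⌋₊ + 1 := by
        rw [Nat.ceil_eq_iff (by omega)]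
        refine ⟨?_, ?_⟩
        · rw [Nat.add_sub_cancel]
          exact lt_of_le_of_ne (Nat.floor_le hz0.le) hint
        · push_cast
          exact (Nat.lt_floor_add_one z).le
      rw [hceil, hIcoIcc]
  -- the derivative of `f`
  obtain ⟨f', hf'⟩ : ∃ f' : ℝ → ℝ, f' = fun t => deriv G (Real.log t / Real.log z) * (t⁻¹ / Real.log z) :=
    ⟨_, rfl⟩
  have hfd : ∀ t, 0 < t → HasDerivAt f (f' t) t := by
    intro t ht
    rw [hf, hf']
    have h1 : HasDerivAt (fun t => Real.log t / Real.log z) (t⁻¹ / Real.log z) t :=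
      (Real.hasDerivAt_log ht.ne').div_const _
    exact (hGd _).hasDerivAt.comp t h1
  have hf'c : ContinuousOn f' (Set.Icc 1 z) := by
    rw [hf']
    refine ContinuousOn.mul ((hG'c.comp_continuousOn ((continuousOn_log.mono ?_).div_const _)))
      (ContinuousOn.div_const (continuousOn_inv₀.mono ?_) _)
    · intro t ht; exact ne_of_gt (by linarith [ht.1] : (0 : ℝ) < t)
    · intro t ht; exact ne_of_gt (by linarith [ht.1] : (0 : ℝ) < t)
  have hderivf : ∀ t ∈ Set.Icc (1 : ℝ) z, deriv f t = f' t := fun t ht =>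
    (hfd t (by linarith [ht.1])).deriv
  -- Abel summation
  have hAbel := sum_mul_eq_sub_integral_mul₀ cs hcs0 z (f := f)
    (fun t ht => (hfd t (by linarith [ht.1])).differentiableAt)
    ((hf'c.integrableOn_Icc).congr_fun (fun t ht => (hderivf t ht).symm) measurableSet_Icc)
  have hfz : f z = G 1 := by rw [hf]; simp [div_self hLz.ne']
  have hint : ∫ t in Set.Ioc 1 z, deriv f t * ∑ k ∈ Icc 0 ⌊t⌋₊, cs k =
      ∫ t in (1 : ℝ)..z, f' t * T t := by
    rw [intervalIntegral.integral_of_le hz1.le, hT]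
    refine setIntegral_congr_fun measurableSet_Ioc fun t ht => ?_
    rw [hderivf t ⟨ht.1.le, ht.2⟩]
  have hTz : ∑ k ∈ Icc 0 ⌊z⌋₊, cs k = T z := by rw [hT]
  rw [hfz, hint, hTz] at hAbel
  -- hAbel : ∑ k ∈ Icc 0 ⌊z⌋₊, f k * cs k = G 1 * T z - ∫ f' T
  -- the calculus identity `∫₁ᶻ f' log = log z (G 1 − ∫₀¹ G)`
  have hparts : ∫ t in (1 : ℝ)..z, f' t * Real.log t = Real.log z * (G 1 - ∫ s in (0 : ℝ)..1, G s) := by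
    have h1 : ∫ t in (1 : ℝ)..z, Real.log t * f' t =
        Real.log z * f z - Real.log 1 * f 1 - ∫ t in (1 : ℝ)..z, t⁻¹ * f t := by
      refine intervalIntegral.integral_mul_deriv_eq_deriv_mul (fun t ht => ?_) (fun t ht => ?_) ?_ ?_
      · rw [uIcc_of_le hz1.le] at ht
        exact Real.hasDerivAt_log (by linarith [ht.1])
      · rw [uIcc_of_le hz1.le] at ht
        exact hfd t (by linarith [ht.1])
      · refine ContinuousOn.intervalIntegrable ?_
        rw [uIcc_of_le hz1.le]
        exact continuousOn_inv₀.mono fun t ht => ne_of_gt (by linarith [ht.1] : (0 : ℝ) < t)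
      · exact (hf'c.mono (by rw [uIcc_of_le hz1.le])).intervalIntegrable
    have h2 : ∫ t in (1 : ℝ)..z, t⁻¹ * f t = Real.log z * ∫ s in (0 : ℝ)..1, G s := by
      rw [← SquarefreeSums.integral_comp_log_div G hGc hz1, ← intervalIntegral.integral_const_mul]
      refine intervalIntegral.integral_congr fun t _ => ?_
      rw [hf]
      field_simp
    calc ∫ t in (1 : ℝ)..z, f' t * Real.log t = ∫ t in (1 : ℝ)..z, Real.log t * f' t := by
          refine intervalIntegral.integral_congr fun t _ => ?_; ring
      _ = _ := by rw [h1, h2, hfz, Real.log_one]; ring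
  -- integrability facts on `[1, z]`
  have hf'T : IntervalIntegrable (fun t => f' t * T t) volume 1 z := by
    rw [intervalIntegrable_iff_integrableOn_Icc_of_le hz1.le, hT]
    exact integrableOn_mul_sum_Icc cs zero_le_one hf'c.integrableOn_Icc
  have hf'log : IntervalIntegrable (fun t => f' t * Real.log t) volume 1 z := by
    refine (ContinuousOn.mul hf'c (continuousOn_log.mono fun t ht => ?_)).intervalIntegrable_of_Icc hz1.le
    exact ne_of_gt (by linarith [ht.1] : (0 : ℝ) < t)
  have hA' : IntervalIntegrable (fun t => c * (f' t * Real.log t)) volume 1 z := hf'log.const_mul c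
  have hR : IntervalIntegrable (fun t => f' t * (T t - c * Real.log t)) volume 1 z := by
    have := hf'T.sub hA'
    convert this using 1
    funext t
    ring
  have hsplit : ∫ t in (1 : ℝ)..z, f' t * T t =
      c * (∫ t in (1 : ℝ)..z, f' t * Real.log t) + ∫ t in (1 : ℝ)..z, f' t * (T t - c * Real.log t) := by
    rw [← intervalIntegral.integral_const_mul, ← intervalIntegral.integral_add hA' hR]
    refine intervalIntegral.integral_congr fun t _ => ?_
    ring
  have herr : |∫ t in (1 : ℝ)..z, f' t * (T t - c * Real.log t)| ≤ M * ρ := by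
    have hbound : ∀ t ∈ Set.Icc (1 : ℝ) z, |f' t * (T t - c * Real.log t)| ≤ M * ρ / Real.log z * t⁻¹ := by
      intro t ht
      have ht0 : 0 < t := by linarith [ht.1]
      have hs : Real.log t / Real.log z ∈ Set.Icc (0 : ℝ) 1 := by
        constructor
        · exact div_nonneg (Real.log_nonneg ht.1) hLz.le
        · rw [div_le_one hLz]; exact Real.log_le_log ht0 ht.2
      rw [abs_mul, hf']
      dsimp only
      rw [abs_mul, abs_of_pos (by positivity : (0 : ℝ) < t⁻¹ / Real.log z)]
      have e1 := hG'M _ hs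
      have e2 := hr t ht.1
      calc |deriv G (Real.log t / Real.log z)| * (t⁻¹ / Real.log z) * |T t - c * Real.log t|
          ≤ M * (t⁻¹ / Real.log z) * ρ := by gcongr
        _ = M * ρ / Real.log z * t⁻¹ := by ring
    calc |∫ t in (1 : ℝ)..z, f' t * (T t - c * Real.log t)|
        ≤ ∫ t in (1 : ℝ)..z, |f' t * (T t - c * Real.log t)| :=
          intervalIntegral.abs_integral_le_integral_abs hz1.le
      _ ≤ ∫ t in (1 : ℝ)..z, M * ρ / Real.log z * t⁻¹ := by
          refine intervalIntegral.integral_mono_on hz1.le hR.norm ?_ hbound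
          refine ContinuousOn.intervalIntegrable_of_Icc hz1.le ?_
          exact (continuousOn_inv₀.mono fun t ht => ne_of_gt (by linarith [ht.1] : (0 : ℝ) < t)).const_smul
            (M * ρ / Real.log z) |>.congr fun t _ => by simp [smul_eq_mul]
      _ = M * ρ := by
          rw [intervalIntegral.integral_const_mul, integral_inv_of_pos zero_lt_one hz0, div_one]
          field_simp
  -- the boundary term
  have hbdry : |(if ((⌊z⌋₊ : ℕ) : ℝ) = z then f ⌊z⌋₊ * cs ⌊z⌋₊ else 0)| ≤ M * (3 * ρ) := by
    split_ifs with hint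
    · have hn2 : 2 ≤ ⌊z⌋₊ := Nat.le_floor (by exact_mod_cast hz)
      have hfz' : f ⌊z⌋₊ = G 1 := by rw [hint, hfz]
      rw [abs_mul, hfz']
      have hG1 : |G 1| ≤ M := hGM 1 ⟨zero_le_one, le_rfl⟩
      calc |G 1| * |cs ⌊z⌋₊| ≤ M * (c + 2 * ρ) := mul_le_mul hG1 (hjump _ hn2) (abs_nonneg _) hM0
        _ ≤ M * (3 * ρ) := by gcongr; linarith
    · rw [abs_zero]; positivity
  -- assemble
  have hG1 : |G 1| ≤ M := hGM 1 ⟨zero_le_one, le_rfl⟩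
  have hrz : |T z - c * Real.log z| ≤ ρ := hr z hz1.le
  have key : moebiusSqGSumWeighted γ F z - c * Real.log z * ∫ x in (0 : ℝ)..1, F (1 - x) =
      G 1 * (T z - c * Real.log z) - (∫ t in (1 : ℝ)..z, f' t * (T t - c * Real.log t))
        - (if ((⌊z⌋₊ : ℕ) : ℝ) = z then f ⌊z⌋₊ * cs ⌊z⌋₊ else 0) := by
    rw [hweighted, hAbel, hsplit, hparts]
    ring
  rw [key]
  calc |G 1 * (T z - c * Real.log z) - (∫ t in (1 : ℝ)..z, f' t * (T t - c * Real.log t))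
          - (if ((⌊z⌋₊ : ℕ) : ℝ) = z then f ⌊z⌋₊ * cs ⌊z⌋₊ else 0)|
      ≤ |G 1 * (T z - c * Real.log z) - ∫ t in (1 : ℝ)..z, f' t * (T t - c * Real.log t)|
          + |(if ((⌊z⌋₊ : ℕ) : ℝ) = z then f ⌊z⌋₊ * cs ⌊z⌋₊ else 0)| := abs_sub _ _
    _ ≤ (|G 1 * (T z - c * Real.log z)| + |∫ t in (1 : ℝ)..z, f' t * (T t - c * Real.log t)|)
          + M * (3 * ρ) := add_le_add (abs_sub _ _) hbdry
    _ ≤ (M * ρ + M * ρ) + M * (3 * ρ) := by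
        refine add_le_add (add_le_add ?_ herr) le_rfl
        rw [abs_mul]
        exact mul_le_mul hG1 hrz (abs_nonneg _) hM0
    _ = 5 * ((C₃' + 1) * (c * L)) * M := by rw [hρ]; ring
    _ ≤ 6 * (C₃' + 1) * cGamma γ * L * M := by
        rw [← hcdef]
        have : 0 ≤ (C₃' + 1) * (c * L) * M := by positivity
        nlinarith

end GGPY

end Literature.NumberTheory.Sieve
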